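import Summits.MatrixMultiplication.MatrixMultiplication.Theorems.SoloInformedCwTwoForms
import Summits.MatrixMultiplication.MatrixMultiplication.Theorems.SoloInformedNullconeHasse
import HarnessLib

/-!
# Seventeen classes below the door tensor over every commutative ring (solo-informed, gen 27)

`SoloInformedCwTwoForms` records seventeen direct monomial certificates `T_{cw,2} ⊵ 2^e · N_k`
(`k ∈ {6,7,10,…,24}`), of which only the eight with `e = 0` are valid in characteristic `2`, and
`SoloInformedNullconeHasse` records thirty-three multiplier-`1` covering degenerations `N_k ⊵ N_l` of
Nurmiev's nullcone, valid over every commutative ring.  CHAINING the two (`PolyDegeneratesTo.trans`)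
removes every power of `2`: starting from the multiplier-`1` certificate `T_{cw,2} ⊵ N₆` and walking
down the every-ring edges `6→7→10→13→{16,17,18}`, `10→14`, `6→12→15`, `7→11`, `16→{19,22}`,
`19→20→21→23→24` one reaches all seventeen classes.

* `cwTensor_two_polyDegeneratesTo_nurmiev_of_mem_ring'` — over EVERY commutative ring `K`,
  `T_{cw,2} ⊵ N_k` for all `k ∈ {6,7,10,11,12,13,14,15,16,17,18,19,20,21,22,23,24}`.
* `cwTensor_two_polyDegeneratesTo_nurmiev_iff_of_mem'` — TWENTY rows of the census of `T_{cw,2}` over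
  EVERY field, characteristic `2` included: for `k ∈ {1,2,4,6,7,10,…,24}`,
  `T_{cw,2} ⊵ N_k ⟺ k ∉ {1,2,4}` (the `Ω`-rank exclusions of `N₁,N₂,N₄` hold over every field).
* `cwTensor_two_not_sThree_of_two_eq_zero` — in characteristic `2` the two `ℤ`-forms of the door part
  ways drastically: `T_{cw,2}` reaches the eleven classes `k ∈ {6,7,10,11,12,13,14,15,16,18,22}` which
  `P = ∑_σ e_σ` does NOT reach (`P`'s characteristic-`2` census is `{17,19,20,21,23,24}`,
  `sThree_polyDegeneratesTo_nurmiev_iff_of_two_eq_zero`).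

What remains open for `T_{cw,2}` in characteristic `2` are the rows `3, 5, 8, 9` (paper level: `5` and `9`
are excluded by the slice cubic `a₀(a₁+a₂)²` of `T_{cw,2}` mod `2`, whose degenerations have lowest forms
`m·n²` or `0`, never three distinct lines).  In characteristic `≠ 2` the census of `T_{cw,2}` is complete
at paper level (rows `3,5,8,9` hold iff `-1` is a square; gen 26 (F3) and gen 27 Theorem G).
-/

namespace Summit.MatrixMultiplication.MatrixMultiplication.Theorems

open Literature.Computability.AlgebraicComplexity
open Literature.Barriers.MatrixMultiplication (PolyDegeneratesTo)

/-- **`T_{cw,2} ⊵ N_k` over EVERY commutative ring** for all seventeen classes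
`k ∈ {6, 7, 10, 11, 12, 13, 14, 15, 16, 17, 18, 19, 20, 21, 22, 23, 24}` — by chaining the
multiplier-`1` certificate `T_{cw,2} ⊵ N₆` with the every-ring covering degenerations of the
nullcone. [cite: Nurmiev2000, Table 2] -/
theorem cwTensor_two_polyDegeneratesTo_nurmiev_of_mem_ring' (K : Type*) [CommRing K] (k : ℕ)
    (hk : k ∈ ({6, 7, 10, 11, 12, 13, 14, 15, 16, 17, 18, 19, 20, 21, 22, 23, 24} : Finset ℕ)) :
    PolyDegeneratesTo (cwTensor K 2) (nurmiev K k) := by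
  obtain ⟨-, -, -, -, -, -, -, h6_7, h6_12, h7_10, h7_11, -, -, -, h10_13, h10_14, -, -, h12_15,
    h13_16, h13_17, h13_18, -, -, h16_19, h16_22, -, -, h19_20, h20_21, h21_23, -, h23_24⟩ :=
    NullconeHasse.nullcone_covers_ring K
  have h6 : PolyDegeneratesTo (cwTensor K 2) (nurmiev K 6) :=
    cwTensor_two_polyDegeneratesTo_nurmiev_of_mem_ring K 6 (by simp)
  have h7 := h6.trans h6_7
  have h10 := h7.trans h7_10
  have h11 := h7.trans h7_11
  have h12 := h6.trans h6_12
  have h13 := h10.trans h10_13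
  have h14 := h10.trans h10_14
  have h15 := h12.trans h12_15
  have h16 := h13.trans h13_16
  have h17 := h13.trans h13_17
  have h18 := h13.trans h13_18
  have h19 := h16.trans h16_19
  have h22 := h16.trans h16_22
  have h20 := h19.trans h19_20
  have h21 := h20.trans h20_21
  have h23 := h21.trans h21_23
  have h24 := h23.trans h23_24
  simp only [Finset.mem_insert, Finset.mem_singleton] at hk
  rcases hk with rfl | rfl | rfl | rfl | rfl | rfl | rfl | rfl | rfl | rfl | rfl | rfl | rfl | rfl | rfl |
    rfl | rfl <;> assumption

/-- **`T_{cw,2} ⊵ N_k` over EVERY field** (any characteristic) for the seventeen classes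
`k ∈ {6, 7, 10, …, 24}`. [cite: Nurmiev2000, Table 2] -/
theorem cwTensor_two_polyDegeneratesTo_nurmiev_of_mem' (K : Type*) [Field K] (k : ℕ)
    (hk : k ∈ ({6, 7, 10, 11, 12, 13, 14, 15, 16, 17, 18, 19, 20, 21, 22, 23, 24} : Finset ℕ)) :
    PolyDegeneratesTo (cwTensor K 2) (nurmiev K k) :=
  cwTensor_two_polyDegeneratesTo_nurmiev_of_mem_ring' K k hk

/-- **Twenty rows of the census of `T_{cw,2}` over EVERY field, characteristic `2` included**:
for `k ∈ {1, 2, 4, 6, 7, 10, …, 24}`, `T_{cw,2} ⊵ N_k ⟺ k ∉ {1, 2, 4}`.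
(The remaining rows `3, 5, 8, 9` hold iff `-1` is a square when `char K ≠ 2` — paper theorems — and
`5, 9` fail, `3, 8` are open when `char K = 2`.) [cite: Nurmiev2000, Table 2] -/
theorem cwTensor_two_polyDegeneratesTo_nurmiev_iff_of_mem' (K : Type*) [Field K] (k : ℕ)
    (hk : k ∈ ({1, 2, 4, 6, 7, 10, 11, 12, 13, 14, 15, 16, 17, 18, 19, 20, 21, 22, 23, 24} :
      Finset ℕ)) :
    PolyDegeneratesTo (cwTensor K 2) (nurmiev K k) ↔ k ∉ ({1, 2, 4} : Finset ℕ) := by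
  by_cases h124 : k ∈ ({1, 2, 4} : Finset ℕ)
  · simp only [h124, not_true_eq_false, iff_false]
    simp only [Finset.mem_insert, Finset.mem_singleton] at h124
    rcases h124 with rfl | rfl | rfl
    · exact CayleyOmega.not_cwTensor_two_polyDegeneratesTo_nurmiev_one K
    · exact CayleyOmega.not_cwTensor_two_polyDegeneratesTo_nurmiev_two K
    · exact CayleyOmega.not_cwTensor_two_polyDegeneratesTo_nurmiev_four K
  · simp only [h124, not_false_eq_true, iff_true]
    apply cwTensor_two_polyDegeneratesTo_nurmiev_of_mem_ring' K
    simp only [Finset.mem_insert, Finset.mem_singleton] at hk h124 ⊢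
    omega

/-- **The two `ℤ`-forms of the door separate in characteristic `2`**: over a field with `2 = 0`,
`T_{cw,2} ⊵ N_k` but `P ⋭ N_k` for each of the eleven classes
`k ∈ {6, 7, 10, 11, 12, 13, 14, 15, 16, 18, 22}`. [cite: Nurmiev2000, Table 2] -/
theorem cwTensor_two_not_sThree_of_two_eq_zero (K : Type*) [Field K] (h2 : (2 : K) = 0) (k : ℕ)
    (hk : k ∈ ({6, 7, 10, 11, 12, 13, 14, 15, 16, 18, 22} : Finset ℕ)) :
    PolyDegeneratesTo (cwTensor K 2) (nurmiev K k) ∧ ¬ PolyDegeneratesTo (sThree K) (nurmiev K k) := by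
  have hk' : k ∈ ({6, 7, 10, 11, 12, 13, 14, 15, 16, 17, 18, 19, 20, 21, 22, 23, 24} : Finset ℕ) := by
    simp only [Finset.mem_insert, Finset.mem_singleton] at hk ⊢; omega
  have hk₁ : 1 ≤ k := by simp only [Finset.mem_insert, Finset.mem_singleton] at hk; omega
  have hk₂ : k ≤ 24 := by simp only [Finset.mem_insert, Finset.mem_singleton] at hk; omega
  refine ⟨cwTensor_two_polyDegeneratesTo_nurmiev_of_mem_ring' K k hk', fun h => ?_⟩
  rw [sThree_polyDegeneratesTo_nurmiev_iff_of_two_eq_zero K h2 hk₁ hk₂] at h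
  simp only [Finset.mem_insert, Finset.mem_singleton] at hk h
  omega


end Summit.MatrixMultiplication.MatrixMultiplication.Theorems
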